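import Literature.AlgebraicGeometry.Motives.HodgeLieReductiveAnyWeight
import Literature.AlgebraicGeometry.Motives.MumfordTateLieAlgebraCentralRadical
import HarnessLib

/-!
# `Lie Hg(H)` and `𝔪𝔱(H)` have central radical for a polarizable Hodge structure of ANY weight (Deligne LNM 900 I Prop. 3.6, Lie form)

Family `hodge`, layer `Literature/AlgebraicGeometry/Motives` (abstract polarizable `ℚ`-Hodge structures; no geometry). Cell
`pub-hodgecm2` (COR-CM), seat `b27` (count-neutral own lane MT-REDUCTIVE); UNCONDITIONAL, theorems only (no definition, no named
fact, D-0026); no step towards a summit statement. The weight-one files `HodgeLieCentralRadical` / `MumfordTateLieAlgebraCentralRadical`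
with the hypotheses `n = 1`, `IsEffective` removed, thanks to `HodgeLieReductiveAnyWeight` (`[Lie Hg, Lie Hg]` has trivial radical
in every weight).

PRINTED RESULT. P. Deligne, LNM 900 (1982), I Prop. 3.6: «Soit `(V, h)` une structure de Hodge rationnelle polarisable. Alors
`MT(V, h)` est réductif» — no weight hypothesis. Yu. G. Zarhin, *Hodge groups of K3 surfaces* (1983) §2 (weight `2`).
Mathlib's «reductive»: `LieAlgebra.HasCentralRadical`.

RESULTS (namespace `HodgeStructure.AnyWeight`; commutator bracket `LieRing.ofAssociativeRing` supplied by a `letI`):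
* `hasCentralRadical_of_derived_le` — every Lie subalgebra `𝔏 ≤ 𝔤𝔩(V)` with `[𝔥,𝔥] ⊆ 𝔏`, `[𝔏,𝔏] ⊆ [𝔥,𝔥]` has `rad 𝔏 = Z(𝔏)`;
* **`hasCentralRadical_of_eq_hodgeLie`** — `Lie Hg(H)` is reductive, ANY weight;
* **`hasCentralRadical_of_eq_mumfordTateLieAlgebra`** — `𝔪𝔱(H)` is reductive, any weight `≠ 0` (DELIGNE I 3.6).
-/

noncomputable section

open scoped TensorProduct

namespace Literature.AlgebraicGeometry.Motives

namespace HodgeStructure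

namespace AnyWeight

universe u

variable {V : Type u} [AddCommGroup V] [Module ℚ V] [Module.Finite ℚ V] [HodgeTensorFacts.{u, u}] {n : ℤ}

/-- **Every Lie subalgebra `𝔏 ≤ 𝔤𝔩(V)` with `[𝔥, 𝔥] ⊆ 𝔏` and `[𝔏, 𝔏] ⊆ [𝔥, 𝔥]` has central radical**, for a polarizable `H`
of ANY weight (the elements of `rad 𝔏` inside the semisimple `[𝔥,𝔥]` form a solvable ideal there, hence vanish, so
`[𝔏, rad 𝔏] = 0`). [cite: Deligne1982HodgeCycles, I §3 Prop. 3.6] [cite: Zarhin1983HodgeGroupsK3, §2] -/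
theorem hasCentralRadical_of_derived_le (H : HodgeStructure V n) (ψ : H.Polarization) :
    letI : LieRing (Module.End ℚ V) := LieRing.ofAssociativeRing
    ∀ (𝔏 : LieSubalgebra ℚ (Module.End ℚ V)),
      Submodule.span ℚ {B | ∃ X ∈ H.hodgeLie, ∃ Y ∈ H.hodgeLie, X * Y - Y * X = B} ≤ 𝔏.toSubmodule →
      (∀ X ∈ 𝔏, ∀ Y ∈ 𝔏, X * Y - Y * X ∈ Submodule.span ℚ {B | ∃ X ∈ H.hodgeLie, ∃ Y ∈ H.hodgeLie, X * Y - Y * X = B}) →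
      LieAlgebra.HasCentralRadical ℚ 𝔏 := by
  letI : LieRing (Module.End ℚ V) := LieRing.ofAssociativeRing
  intro 𝔏 h𝔡𝔏 hbr𝔏
  classical
  have hmem : ∀ X : Module.End ℚ V,
      X ∈ Submodule.span ℚ {B | ∃ X ∈ H.hodgeLie, ∃ Y ∈ H.hodgeLie, X * Y - Y * X = B} → X ∈ 𝔏 := fun X hX => by
    rw [← LieSubalgebra.mem_toSubmodule]; exact h𝔡𝔏 hX
  -- the derived algebra as a Lie subalgebra `𝔏d`, with trivial radical
  obtain ⟨𝔏d, h𝔏d⟩ := exists_lieSubalgebra_eq_hodgeLie_derived H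
  haveI hrad : LieAlgebra.HasTrivialRadical ℚ 𝔏d := AnyWeight.hasTrivialRadical_of_eq_hodgeLie_derived H ψ 𝔏d h𝔏d
  have hmemd : ∀ X : Module.End ℚ V, X ∈ 𝔏d ↔
      X ∈ Submodule.span ℚ {B | ∃ X ∈ H.hodgeLie, ∃ Y ∈ H.hodgeLie, X * Y - Y * X = B} := fun X => by
    rw [← LieSubalgebra.mem_toSubmodule, h𝔏d]
  set R : LieIdeal ℚ 𝔏 := LieAlgebra.radical ℚ 𝔏 with hR
  -- the elements of `R` lying in `𝔡`, as a Lie ideal of `𝔏d`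
  let R' : LieIdeal ℚ 𝔏d :=
    { carrier := {d | ∃ r : 𝔏, r ∈ R ∧ (r : Module.End ℚ V) = d}
      add_mem' := by
        rintro d d' ⟨r, hr, hrd⟩ ⟨r', hr', hrd'⟩
        refine ⟨r + r', R.add_mem hr hr', ?_⟩
        change (r : Module.End ℚ V) + r' = (d : Module.End ℚ V) + d'
        rw [hrd, hrd']
      zero_mem' := ⟨0, R.zero_mem, rfl⟩
      smul_mem' := by
        rintro c d ⟨r, hr, hrd⟩
        refine ⟨c • r, R.smul_mem c hr, ?_⟩
        change c • (r : Module.End ℚ V) = c • (d : Module.End ℚ V)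
        rw [hrd]
      lie_mem := by
        rintro x d ⟨r, hr, hrd⟩
        have hx𝔏 : ((x : 𝔏d) : Module.End ℚ V) ∈ 𝔏 := hmem _ ((hmemd _).1 x.2)
        refine ⟨⁅(⟨(x : Module.End ℚ V), hx𝔏⟩ : 𝔏), r⁆, R.lie_mem hr, ?_⟩
        rw [LieSubalgebra.coe_bracket, LieRing.of_associative_ring_bracket, hrd, LieSubalgebra.coe_bracket,
          LieRing.of_associative_ring_bracket] }
  have hR'mem : ∀ d : 𝔏d, d ∈ R' ↔ ∃ r : 𝔏, r ∈ R ∧ (r : Module.End ℚ V) = d := fun d => Iff.rfl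
  -- `R'` embeds into `R`, hence is solvable
  choose ρ hρR hρval using fun d : R' => (hR'mem _).1 d.2
  have hcoe : ∀ d d' : R', ((⁅d, d'⁆ : R') : 𝔏d) = ⁅(d : 𝔏d), (d' : 𝔏d)⁆ := fun d d' => rfl
  have hcoeR : ∀ a b : R, ((⁅a, b⁆ : R) : 𝔏) = ⁅(a : 𝔏), (b : 𝔏)⁆ := fun a b => rfl
  let φ : R' →ₗ⁅ℚ⁆ R :=
    { toFun := fun d => ⟨ρ d, hρR d⟩
      map_add' := fun d d' => by
        apply Subtype.ext; apply Subtype.ext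
        change (ρ (d + d') : Module.End ℚ V) = (ρ d : Module.End ℚ V) + ρ d'
        rw [hρval, hρval, hρval]
        rfl
      map_smul' := fun c d => by
        apply Subtype.ext; apply Subtype.ext
        change (ρ (c • d) : Module.End ℚ V) = c • (ρ d : Module.End ℚ V)
        rw [hρval, hρval]
        rfl
      map_lie' := fun {d d'} => by
        apply Subtype.ext; apply Subtype.ext
        change (ρ ⁅d, d'⁆ : Module.End ℚ V) = (((⁅(⟨ρ d, hρR d⟩ : R), ⟨ρ d', hρR d'⟩⁆ : R) : 𝔏) : Module.End ℚ V)
        rw [hρval, hcoe, hcoeR, LieSubalgebra.coe_bracket, LieRing.of_associative_ring_bracket,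
          LieSubalgebra.coe_bracket, LieRing.of_associative_ring_bracket]
        change _ = (ρ d : Module.End ℚ V) * ρ d' - ρ d' * ρ d
        rw [hρval, hρval] }
  have hφinj : Function.Injective φ := by
    intro d d' h
    have h' : (ρ d : Module.End ℚ V) = ρ d' := congrArg (fun r : R => ((r : 𝔏) : Module.End ℚ V)) h
    rw [hρval, hρval] at h'
    exact Subtype.ext (Subtype.ext h')
  haveI : LieAlgebra.IsSolvable R' := hφinj.lieAlgebra_isSolvable
  have hR'bot : R' = ⊥ := LieAlgebra.HasTrivialRadical.eq_bot_of_isSolvable R'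
  -- hence `[𝔏, R] = 0`: the radical is central
  refine LieAlgebra.hasCentralRadical_of_radical_le ℚ 𝔏 fun r hr => ?_
  rw [LieAlgebra.center, LieModule.mem_maxTrivSubmodule]
  intro x
  have hxr𝔡 : ((⁅x, r⁆ : 𝔏) : Module.End ℚ V) ∈
      Submodule.span ℚ {B | ∃ X ∈ H.hodgeLie, ∃ Y ∈ H.hodgeLie, X * Y - Y * X = B} := by
    rw [LieSubalgebra.coe_bracket, LieRing.of_associative_ring_bracket]
    exact hbr𝔏 _ x.2 _ r.2
  have hmemR' : (⟨((⁅x, r⁆ : 𝔏) : Module.End ℚ V), (hmemd _).2 hxr𝔡⟩ : 𝔏d) ∈ R' :=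
    (hR'mem _).2 ⟨⁅x, r⁆, R.lie_mem hr, rfl⟩
  rw [hR'bot, LieSubmodule.mem_bot] at hmemR'
  have h0 : ((⁅x, r⁆ : 𝔏) : Module.End ℚ V) = 0 := congrArg Subtype.val hmemR'
  exact Subtype.ext h0

/-- **`Lie Hg(H)` is reductive for a polarizable Hodge structure of ANY weight**: `rad 𝔏 = Z(𝔏)` for every Lie subalgebra
`𝔏 ≤ 𝔤𝔩(V)` with carrier `hodgeLie H`. [cite: Deligne1982HodgeCycles, I §3 Prop. 3.6] [cite: Zarhin1983HodgeGroupsK3, §2] -/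
theorem hasCentralRadical_of_eq_hodgeLie (H : HodgeStructure V n) (ψ : H.Polarization) :
    letI : LieRing (Module.End ℚ V) := LieRing.ofAssociativeRing
    ∀ (𝔏 : LieSubalgebra ℚ (Module.End ℚ V)), 𝔏.toSubmodule = H.hodgeLie → LieAlgebra.HasCentralRadical ℚ 𝔏 := by
  letI : LieRing (Module.End ℚ V) := LieRing.ofAssociativeRing
  intro 𝔏 h𝔏
  have hmem : ∀ X : Module.End ℚ V, X ∈ 𝔏 ↔ X ∈ H.hodgeLie := fun X => by
    rw [← LieSubalgebra.mem_toSubmodule, h𝔏]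
  refine hasCentralRadical_of_derived_le H ψ 𝔏 ?_ ?_
  · rw [h𝔏]
    exact Literature.Algebra.Lie.TraceSeparating.derived_le H.hodgeLie fun _ hX _ hY => H.commutator_mem_hodgeLie hX hY
  · intro X hX Y hY
    exact Literature.Algebra.Lie.TraceSeparating.commutator_mem_derived H.hodgeLie ((hmem X).1 hX) ((hmem Y).1 hY)

/-- **DELIGNE I 3.6, Lie form, any non-zero weight: the Mumford–Tate Lie algebra of a polarizable Hodge structure is
reductive** — `rad 𝔏 = Z(𝔏)` for every Lie subalgebra `𝔏 ≤ 𝔤𝔩(V)` with carrier `mumfordTateLieAlgebra H` (weight `n ≠ 0`,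
where `𝔪𝔱 = 𝔥 ⊕ ℚ·id`). [cite: Deligne1982HodgeCycles, I §3 Prop. 3.6] -/
theorem hasCentralRadical_of_eq_mumfordTateLieAlgebra (H : HodgeStructure V n) (ψ : H.Polarization) (hn : n ≠ 0) :
    letI : LieRing (Module.End ℚ V) := LieRing.ofAssociativeRing
    ∀ (𝔏 : LieSubalgebra ℚ (Module.End ℚ V)), 𝔏.toSubmodule = H.mumfordTateLieAlgebra →
      LieAlgebra.HasCentralRadical ℚ 𝔏 := by
  letI : LieRing (Module.End ℚ V) := LieRing.ofAssociativeRing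
  intro 𝔏 h𝔏
  have hmem : ∀ X : Module.End ℚ V, X ∈ 𝔏 ↔ X ∈ H.mumfordTateLieAlgebra := fun X => by
    rw [← LieSubalgebra.mem_toSubmodule, h𝔏]
  refine hasCentralRadical_of_derived_le H ψ 𝔏 (h𝔏 ▸ hodgeLie_derived_le_mumfordTateLieAlgebra H) ?_
  intro X hX Y hY
  exact commutator_mem_hodgeLie_derived_of_mem_mumfordTateLieAlgebra H ψ hn ((hmem X).1 hX) ((hmem Y).1 hY)

end AnyWeight

end HodgeStructure

end Literature.AlgebraicGeometry.Motives

end
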